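import Mathlib.MeasureTheory.Measure.Lebesgue.EqHaar
import Mathlib.MeasureTheory.Measure.Haar.InnerProductSpace
import Mathlib.MeasureTheory.Integral.Lebesgue.Basic
import Mathlib.Analysis.InnerProductSpace.PiL2
import Mathlib.Analysis.SpecificLimits.Basic
import HarnessLib

/-!
# Leslie–Shvydkoy 2018, Prop. 3.2: the dyadic ball energies `E_k(t, r)` and their supremum

Analysis/FluidPDE proofs file (one auxiliary definition, theorems; no named facts) on the
discharge path of the named fact `Literature.Analysis.FluidPDE.leslieShvydkoy2018_morreyBound`
(`LeslieShvydkoy2018MorreyBound.lean`; T. M. Leslie, R. Shvydkoy, *The energy measure for the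
Euler and Navier–Stokes equations*, ARMA 230 (2018) = arXiv:1705.04420, Prop. 3.2 + Prop. 4.2).

The printed proof (§3.4, p. 10–12) works with the localised energies
`E(t, r) = ∫ |u(x,t)|² φ_r(x) dx` and their dyadic rescalings `E_k(t, r) = E(t, 2^k r)/2^{kn}`,
and closes an iteration in which the bound for `E_k` involves `Σ_{j ∈ ℕ} 2^{-j} E_j` at all larger
dyadic scales ("We don't actually use the fact that this last sum starts from `j = k+1`; for our
purposes it suffices to use a rougher bound, where we trivially replace the sum above with a sum
over all of `ℕ`", (3.12')). The tree's rendering replaces the `M`-fold iteration (3.14) by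
Grönwall's lemma for the single quantity

  `W_R(v) = sup_{k ≥ 0} 8^{-k} ∫_{B(x₀, 2^k R)} |v|²`  (`dyadicEnergySup v x₀ R`, `n = 3`),

the supremum of the printed `E_k` with balls in place of the smooth weights (the weights only
enter the one-step energy identity, `LeslieShvydkoy2018EnergyStep.lean`). This file collects the
elementary slice inequalities the printed proof uses for a velocity slice `v : ℝ³ → ℝ³` with the
sup bound `‖v‖ ≤ F` (`f(t) = ‖u(t)‖_{L^∞}` in print):

* `ballEnergySq_le_pow_mul_dyadicEnergySup` — `∫_{B(x₀,2^k R)} |v|² ≤ 8^k W_R(v)`;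
* `dyadicEnergySup_le_lintegral` — `W_R(v) ≤ ∫ |v|²` (the bound by `‖u‖_{L^∞L²}` used to
  terminate the iteration, p. 12);
* `dyadicEnergySup_two_mul_le` — `W_{2R}(v) ≤ 8 W_R(v)` (the rescaling identity (3.11'),
  `E_j(t, 2^k r)/2^{kn} = E_{j+k}(t, r)`);
* `dyadicEnergySup_le_of_norm_le` — `W_R(v) ≤ |B₁| F² R³` (the initial bound
  `E(s, r) ≤ r^n f(s)²`, first term of (3.12));
* `lintegral_enorm_cube_le_of_norm_le`, `lintegral_ball_enorm_cube_le_of_norm_le` —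
  `∫_B |v|³ ≤ F ∫_B |v|²` and `∫_{B(x₀,r)} |v|³ ≤ F³ r³ |B₁|` (the two uses of the sup bound in
  "`‖u(τ)‖_{L³(B_r)} ≤ C f(τ)^{1/3} E(τ,2r)^{1/3} ≤ C f(τ) r^{n/3}`", p. 11);
* `lintegral_shell_le_dyadicEnergySup` — the dyadic shell bound
  `∫_{|y-x₀| > 2R} |v|²|y-x₀|⁻⁴ ≤ 8 R⁻⁴ W_R(v)` ("we split the remaining integral into dyadic
  shells, estimate `|y|^{-n-1}` on each shell, and then replace the shells with balls", p. 11).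

## References

* T. M. Leslie, R. Shvydkoy, ARMA 230 (2018) 459–492 = arXiv:1705.04420, §3.4 (proof of
  Prop. 3.2), pp. 10–12. [`LeslieShvydkoy2017`]
-/

noncomputable section

open MeasureTheory Set Metric Filter Function
open scoped ENNReal NNReal Topology

namespace Literature.Analysis.FluidPDE

namespace LeslieShvydkoy2018

variable {v : EuclideanSpace ℝ (Fin 3) → EuclideanSpace ℝ (Fin 3)} {x₀ : EuclideanSpace ℝ (Fin 3)}
  {R : ℝ}

/-! ### The dyadic supremum of ball energies -/

/-- **The dyadic supremum of the ball energies of a slice** (Leslie–Shvydkoy's `sup_k E_k(t, r)`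
with balls for weights, `n = 3`): `W_R(v) = sup_{k ≥ 0} 8^{-k} ∫_{B(x₀, 2^k R)} |v|²`.
[cite: LeslieShvydkoy2017, §3.4, definition of `E_k(t,r)` (p. 10) and (3.12') (p. 11)] -/
def dyadicEnergySup (v : EuclideanSpace ℝ (Fin 3) → EuclideanSpace ℝ (Fin 3))
    (x₀ : EuclideanSpace ℝ (Fin 3)) (R : ℝ) : ℝ≥0∞ :=
  ⨆ k : ℕ, (∫⁻ y in ball x₀ (2 ^ k * R), ‖v y‖ₑ ^ 2) / 8 ^ k

/-- Unfolding `dyadicEnergySup`. [cite: LeslieShvydkoy2017, §3.4, `E_k(t,r)` (p. 10)] -/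
theorem dyadicEnergySup_def (v : EuclideanSpace ℝ (Fin 3) → EuclideanSpace ℝ (Fin 3))
    (x₀ : EuclideanSpace ℝ (Fin 3)) (R : ℝ) :
    dyadicEnergySup v x₀ R = ⨆ k : ℕ, (∫⁻ y in ball x₀ (2 ^ k * R), ‖v y‖ₑ ^ 2) / 8 ^ k := rfl

/-- `8^k ≠ 0` in `ℝ≥0∞`. [folklore] -/
private theorem eight_pow_ne_zero (k : ℕ) : (8 : ℝ≥0∞) ^ k ≠ 0 :=
  pow_ne_zero _ (by norm_num)

/-- `8^k ≠ ∞` in `ℝ≥0∞`. [folklore] -/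
private theorem eight_pow_ne_top (k : ℕ) : (8 : ℝ≥0∞) ^ k ≠ ⊤ :=
  ENNReal.pow_ne_top (by norm_num)

/-- Each dyadic term is below the supremum: `∫_{B(x₀,2^k R)} |v|² / 8^k ≤ W_R(v)`
(`E_k ≤ sup_j E_j`). [cite: LeslieShvydkoy2017, §3.4 (3.12') (p. 11)] -/
theorem ballEnergySq_div_le_dyadicEnergySup (k : ℕ) :
    (∫⁻ y in ball x₀ (2 ^ k * R), ‖v y‖ₑ ^ 2) / 8 ^ k ≤ dyadicEnergySup v x₀ R :=
  le_iSup (fun k : ℕ => (∫⁻ y in ball x₀ (2 ^ k * R), ‖v y‖ₑ ^ 2) / 8 ^ k) k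

/-- **`∫_{B(x₀, 2^k R)} |v|² ≤ 8^k W_R(v)`** (`E_k ≤ sup_j E_j`, unnormalised).
[cite: LeslieShvydkoy2017, §3.4 (3.12') (p. 11)] -/
theorem ballEnergySq_le_pow_mul_dyadicEnergySup (k : ℕ) :
    ∫⁻ y in ball x₀ (2 ^ k * R), ‖v y‖ₑ ^ 2 ≤ 8 ^ k * dyadicEnergySup v x₀ R := by
  have h := ballEnergySq_div_le_dyadicEnergySup (v := v) (x₀ := x₀) (R := R) k
  rw [ENNReal.div_le_iff_le_mul (Or.inl (eight_pow_ne_zero k)) (Or.inl (eight_pow_ne_top k))]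
    at h
  exact h.trans_eq (mul_comm _ _)

/-- The base ball is below the supremum: `∫_{B(x₀, R)} |v|² ≤ W_R(v)` (the term `k = 0`,
`E = E₀`). [cite: LeslieShvydkoy2017, §3.4 (3.12) (p. 11)] -/
theorem ballEnergySq_le_dyadicEnergySup :
    ∫⁻ y in ball x₀ R, ‖v y‖ₑ ^ 2 ≤ dyadicEnergySup v x₀ R := by
  simpa using ballEnergySq_le_pow_mul_dyadicEnergySup (v := v) (x₀ := x₀) (R := R) 0

/-- **`W_R(v) ≤ ∫ |v|²`**: the dyadic supremum is controlled by the total energy (the bound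
"estimate each `E_{k_M}(t_M, r)` trivially by `‖u‖_{L^∞L²}`", p. 12).
[cite: LeslieShvydkoy2017, §3.4, proof of (3.14) (p. 12)] -/
theorem dyadicEnergySup_le_lintegral :
    dyadicEnergySup v x₀ R ≤ ∫⁻ y, ‖v y‖ₑ ^ 2 := by
  refine iSup_le fun k => ?_
  calc (∫⁻ y in ball x₀ (2 ^ k * R), ‖v y‖ₑ ^ 2) / 8 ^ k
      ≤ (∫⁻ y in ball x₀ (2 ^ k * R), ‖v y‖ₑ ^ 2) / 1 := by
        gcongr
        exact one_le_pow₀ (by norm_num)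
    _ = ∫⁻ y in ball x₀ (2 ^ k * R), ‖v y‖ₑ ^ 2 := by rw [div_one]
    _ ≤ ∫⁻ y, ‖v y‖ₑ ^ 2 := setLIntegral_le_lintegral _ _

/-- **Rescaling: `W_{2R}(v) ≤ 8 W_R(v)`** (the printed identity
`E_j(t, 2^k r)/2^{kn} = E_{j+k}(t, r)` (3.11') with `k = 1`, `n = 3`).
[cite: LeslieShvydkoy2017, §3.4 (3.11') (p. 11)] -/
theorem dyadicEnergySup_two_mul_le :
    dyadicEnergySup v x₀ (2 * R) ≤ 8 * dyadicEnergySup v x₀ R := by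
  refine iSup_le fun k => ?_
  have hrad : (2 : ℝ) ^ k * (2 * R) = 2 ^ (k + 1) * R := by ring
  rw [hrad]
  have h := ballEnergySq_div_le_dyadicEnergySup (v := v) (x₀ := x₀) (R := R) (k + 1)
  -- `a / 8^k = 8 * (a / 8^(k+1))`
  have e : (∫⁻ y in ball x₀ (2 ^ (k + 1) * R), ‖v y‖ₑ ^ 2) / 8 ^ k =
      8 * ((∫⁻ y in ball x₀ (2 ^ (k + 1) * R), ‖v y‖ₑ ^ 2) / 8 ^ (k + 1)) := by
    rw [ENNReal.div_eq_inv_mul, ENNReal.div_eq_inv_mul, ← mul_assoc]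
    congr 1
    rw [pow_succ, ENNReal.mul_inv (Or.inl (eight_pow_ne_zero k)) (Or.inl (eight_pow_ne_top k)),
      mul_comm ((8 : ℝ≥0∞) ^ k)⁻¹ 8⁻¹, ← mul_assoc,
      ENNReal.mul_inv_cancel (by norm_num) (by norm_num), one_mul]
  rw [e]
  gcongr

/-! ### Slice inequalities under a sup bound `‖v‖ ≤ F` -/

/-- The volume of a ball of `ℝ³`: `|B(x₀, r)| = r³ |B₁|` for `r ≥ 0`. [folklore] -/
private theorem volume_ball_fin_three (x₀ : EuclideanSpace ℝ (Fin 3)) {r : ℝ} (hr : 0 ≤ r) :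
    volume (ball x₀ r) = ENNReal.ofReal (r ^ 3) * volume (ball (0 : EuclideanSpace ℝ (Fin 3)) 1) := by
  rw [Measure.addHaar_ball volume x₀ hr, finrank_euclideanSpace_fin]

/-- **The ball energy under a sup bound**: `∫_{B(x₀,r)} |v|² ≤ F² r³ |B₁|` for `‖v‖ ≤ F`.
[cite: LeslieShvydkoy2017, §3.4, first term of (3.12) `E(s,r) ≤ rⁿ f(s)²` (p. 11)] -/
theorem ballEnergySq_le_of_norm_le {F : ℝ} (hF : ∀ y, ‖v y‖ ≤ F) {r : ℝ} (hr : 0 ≤ r) :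
    ∫⁻ y in ball x₀ r, ‖v y‖ₑ ^ 2 ≤
      ENNReal.ofReal (F ^ 2 * r ^ 3) * volume (ball (0 : EuclideanSpace ℝ (Fin 3)) 1) := by
  have hF0 : 0 ≤ F := (norm_nonneg _).trans (hF x₀)
  have hpt : ∀ y, ‖v y‖ₑ ^ 2 ≤ ENNReal.ofReal (F ^ 2) := fun y => by
    rw [← ofReal_norm, ← ENNReal.ofReal_pow (norm_nonneg _)]
    exact ENNReal.ofReal_le_ofReal (pow_le_pow_left₀ (norm_nonneg _) (hF y) 2)
  calc ∫⁻ y in ball x₀ r, ‖v y‖ₑ ^ 2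
      ≤ ∫⁻ _ in ball x₀ r, ENNReal.ofReal (F ^ 2) := lintegral_mono fun y => hpt y
    _ = ENNReal.ofReal (F ^ 2) * volume (ball x₀ r) := by
        rw [lintegral_const, Measure.restrict_apply_univ]
    _ = ENNReal.ofReal (F ^ 2 * r ^ 3) * volume (ball (0 : EuclideanSpace ℝ (Fin 3)) 1) := by
        rw [volume_ball_fin_three x₀ hr, ← mul_assoc, ← ENNReal.ofReal_mul (sq_nonneg _)]

/-- **The dyadic supremum under a sup bound**: `W_R(v) ≤ F² R³ |B₁|` for `‖v‖ ≤ F`, `R ≥ 0`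
(each term: `8^{-k} F² (2^k R)³ |B₁| = F² R³ |B₁|`).
[cite: LeslieShvydkoy2017, §3.4, first term of (3.12') (p. 11)] -/
theorem dyadicEnergySup_le_of_norm_le {F : ℝ} (hF : ∀ y, ‖v y‖ ≤ F) (hR : 0 ≤ R) :
    dyadicEnergySup v x₀ R ≤
      ENNReal.ofReal (F ^ 2 * R ^ 3) * volume (ball (0 : EuclideanSpace ℝ (Fin 3)) 1) := by
  refine iSup_le fun k => ?_
  have h2k : (0 : ℝ) ≤ 2 ^ k * R := mul_nonneg (pow_nonneg (by norm_num) _) hR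
  rw [ENNReal.div_le_iff_le_mul (Or.inl (eight_pow_ne_zero k)) (Or.inl (eight_pow_ne_top k))]
  refine (ballEnergySq_le_of_norm_le hF h2k).trans (le_of_eq ?_)
  have e8 : (8 : ℝ≥0∞) ^ k = ENNReal.ofReal ((2 ^ k) ^ 3) := by
    rw [← pow_mul, mul_comm, pow_mul, ENNReal.ofReal_pow (by norm_num)]
    norm_num
  rw [e8, mul_right_comm, ← ENNReal.ofReal_mul (by positivity)]
  congr 2
  ring

/-- **The cubic slice bound**: `∫_B |v|³ ≤ F ∫_B |v|²` for `‖v‖ ≤ F` (on any set `B`).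
[cite: LeslieShvydkoy2017, §3.4, "`‖u(τ)‖_{L³(B_r)} ≤ C f(τ)^{1/3} E(τ,2r)^{1/3}`" (p. 11)] -/
theorem lintegral_enorm_cube_le_of_norm_le {F : ℝ} (hF : ∀ y, ‖v y‖ ≤ F)
    (B : Set (EuclideanSpace ℝ (Fin 3))) :
    ∫⁻ y in B, ‖v y‖ₑ ^ (3 : ℕ) ≤ ENNReal.ofReal F * ∫⁻ y in B, ‖v y‖ₑ ^ 2 := by
  rw [← lintegral_const_mul' _ _ ENNReal.ofReal_ne_top]
  refine lintegral_mono fun y => ?_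
  have h1 : ‖v y‖ₑ ≤ ENNReal.ofReal F := by
    rw [← ofReal_norm]; exact ENNReal.ofReal_le_ofReal (hF y)
  calc ‖v y‖ₑ ^ (3 : ℕ) = ‖v y‖ₑ * ‖v y‖ₑ ^ 2 := by ring
    _ ≤ ENNReal.ofReal F * ‖v y‖ₑ ^ 2 := by gcongr

/-- **The cubic ball integral under a sup bound**: `∫_{B(x₀,r)} |v|³ ≤ F³ r³ |B₁|` for
`‖v‖ ≤ F` ("`‖u(τ)‖_{L³(B_r)} ≤ C f(τ) r^{n/3}`", p. 11).
[cite: LeslieShvydkoy2017, §3.4, display before (3.17) (p. 11)] -/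
theorem lintegral_ball_enorm_cube_le_of_norm_le {F : ℝ} (hF : ∀ y, ‖v y‖ ≤ F) {r : ℝ}
    (hr : 0 ≤ r) :
    ∫⁻ y in ball x₀ r, ‖v y‖ₑ ^ (3 : ℕ) ≤
      ENNReal.ofReal (F ^ 3 * r ^ 3) * volume (ball (0 : EuclideanSpace ℝ (Fin 3)) 1) := by
  have hF0 : 0 ≤ F := (norm_nonneg _).trans (hF x₀)
  have hpt : ∀ y, ‖v y‖ₑ ^ (3 : ℕ) ≤ ENNReal.ofReal (F ^ 3) := fun y => by
    rw [← ofReal_norm, ← ENNReal.ofReal_pow (norm_nonneg _)]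
    exact ENNReal.ofReal_le_ofReal (pow_le_pow_left₀ (norm_nonneg _) (hF y) 3)
  calc ∫⁻ y in ball x₀ r, ‖v y‖ₑ ^ (3 : ℕ)
      ≤ ∫⁻ _ in ball x₀ r, ENNReal.ofReal (F ^ 3) := lintegral_mono fun y => hpt y
    _ = ENNReal.ofReal (F ^ 3) * volume (ball x₀ r) := by
        rw [lintegral_const, Measure.restrict_apply_univ]
    _ = ENNReal.ofReal (F ^ 3 * r ^ 3) * volume (ball (0 : EuclideanSpace ℝ (Fin 3)) 1) := by
        rw [volume_ball_fin_three x₀ hr, ← mul_assoc, ← ENNReal.ofReal_mul (pow_nonneg hF0 3)]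

/-! ### The dyadic shell bound -/

/-- The half-open dyadic annuli `{2^n R ≤ |y - x₀| < 2^{n+1} R}`, `n ≥ 1`, cover the exterior
`{2R < |y - x₀|}` (for `R > 0`). [folklore] -/
private theorem shell_subset_iUnion_annuli (hR : 0 < R) :
    {y : EuclideanSpace ℝ (Fin 3) | 2 * R < dist y x₀} ⊆
      ⋃ n : ℕ, {y | 2 ^ (n + 1) * R ≤ dist y x₀ ∧ dist y x₀ < 2 ^ (n + 2) * R} := by
  intro y hy
  simp only [mem_setOf_eq] at hy
  have hx : (1 : ℝ) ≤ dist y x₀ / R := by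
    rw [le_div_iff₀ hR]; linarith
  obtain ⟨m, hm1, hm2⟩ := exists_nat_pow_near hx one_lt_two
  -- `m ≥ 1` since `dist/R > 2`
  have hm : 1 ≤ m := by
    by_contra h0
    push Not at h0
    have : m = 0 := by omega
    rw [this, zero_add, pow_one, div_lt_iff₀ hR] at hm2
    linarith
  obtain ⟨n, rfl⟩ := Nat.exists_eq_add_of_le' hm
  refine mem_iUnion.2 ⟨n, ?_, ?_⟩
  · have := (le_div_iff₀ hR).1 hm1; linarith
  · have := (div_lt_iff₀ hR).1 hm2
    simpa [pow_succ] using this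

/-- On the `n`-th annulus the kernel `|y - x₀|⁻⁴` is at most `(2^{n+1} R)⁻⁴` and the annulus lies
in the ball `B(x₀, 2^{n+2} R)`: the annulus piece of the shell integral is
`≤ (2^{n+1}R)⁻⁴ · 8^{n+2} W_R(v)`. [cite: LeslieShvydkoy2017, §3.4, dyadic shells (p. 11)] -/
theorem lintegral_annulus_le (hR : 0 < R) (n : ℕ) :
    ∫⁻ y in {y | 2 ^ (n + 1) * R ≤ dist y x₀ ∧ dist y x₀ < 2 ^ (n + 2) * R},
        ‖v y‖ₑ ^ 2 / ENNReal.ofReal (dist y x₀ ^ 4) ≤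
      (ENNReal.ofReal (((2 : ℝ) ^ (n + 1) * R) ^ 4))⁻¹ * (8 ^ (n + 2) * dyadicEnergySup v x₀ R) := by
  set A : Set (EuclideanSpace ℝ (Fin 3)) :=
    {y | 2 ^ (n + 1) * R ≤ dist y x₀ ∧ dist y x₀ < 2 ^ (n + 2) * R} with hA
  have hAm : MeasurableSet A :=
    (measurableSet_le measurable_const (measurable_id.dist measurable_const)).inter
      (measurableSet_lt (measurable_id.dist measurable_const) measurable_const)
  have hlow : (0 : ℝ) < 2 ^ (n + 1) * R := by positivity
  -- pointwise bound of the kernel on the annulus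
  have hpt : ∀ y ∈ A, ‖v y‖ₑ ^ 2 / ENNReal.ofReal (dist y x₀ ^ 4) ≤
      ‖v y‖ₑ ^ 2 * (ENNReal.ofReal (((2 : ℝ) ^ (n + 1) * R) ^ 4))⁻¹ := by
    intro y hy
    rw [ENNReal.div_eq_inv_mul, mul_comm]
    gcongr
    exact hy.1
  calc ∫⁻ y in A, ‖v y‖ₑ ^ 2 / ENNReal.ofReal (dist y x₀ ^ 4)
      ≤ ∫⁻ y in A, ‖v y‖ₑ ^ 2 * (ENNReal.ofReal (((2 : ℝ) ^ (n + 1) * R) ^ 4))⁻¹ :=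
        setLIntegral_mono' hAm hpt
    _ = (∫⁻ y in A, ‖v y‖ₑ ^ 2) * (ENNReal.ofReal (((2 : ℝ) ^ (n + 1) * R) ^ 4))⁻¹ := by
        rw [lintegral_mul_const' _ _ (ENNReal.inv_ne_top.2 ((ENNReal.ofReal_pos.2
          (by positivity)).ne'))]
    _ ≤ (∫⁻ y in ball x₀ (2 ^ (n + 2) * R), ‖v y‖ₑ ^ 2) *
          (ENNReal.ofReal (((2 : ℝ) ^ (n + 1) * R) ^ 4))⁻¹ := by
        gcongr ?_ * _
        exact lintegral_mono_set fun y hy => mem_ball.2 hy.2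
    _ ≤ (8 ^ (n + 2) * dyadicEnergySup v x₀ R) *
          (ENNReal.ofReal (((2 : ℝ) ^ (n + 1) * R) ^ 4))⁻¹ := by
        gcongr
        exact ballEnergySq_le_pow_mul_dyadicEnergySup (n + 2)
    _ = _ := mul_comm _ _

/-- The constants of the annulus pieces sum: `(2^{n+1}R)⁻⁴ 8^{n+2} = 4 R⁻⁴ 2^{-n}`, and
`Σ_n 2^{-n} = 2`. [folklore] -/
private theorem annulus_const_eq (hR : 0 < R) (n : ℕ) :
    (ENNReal.ofReal (((2 : ℝ) ^ (n + 1) * R) ^ 4))⁻¹ * (8 : ℝ≥0∞) ^ (n + 2) =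
      ENNReal.ofReal (4 * (R ^ 4)⁻¹) * (2⁻¹ : ℝ≥0∞) ^ n := by
  have h2n : (0 : ℝ) < 2 ^ n := by positivity
  have h83 : (2 : ℝ) ^ (3 * n) = 8 ^ n := by rw [pow_mul]; norm_num
  have e1 : ((2 : ℝ) ^ (n + 1) * R) ^ 4 = 2 ^ n * (16 * 8 ^ n * R ^ 4) := by
    rw [← h83]; ring
  have e8 : (8 : ℝ≥0∞) ^ (n + 2) = ENNReal.ofReal (64 * 8 ^ n) := by
    rw [show (8 : ℝ≥0∞) = ENNReal.ofReal 8 by norm_num, ← ENNReal.ofReal_pow (by norm_num)]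
    congr 1
    ring
  have einv : (2⁻¹ : ℝ≥0∞) ^ n = ENNReal.ofReal ((2 ^ n)⁻¹) := by
    rw [ENNReal.ofReal_inv_of_pos h2n, ENNReal.ofReal_pow (by norm_num), ENNReal.inv_pow]
    norm_num
  rw [e1, e8, einv, ← ENNReal.ofReal_inv_of_pos (by positivity),
    ← ENNReal.ofReal_mul (by positivity), ← ENNReal.ofReal_mul (by positivity)]
  congr 1
  field_simp
  ring

/-- **The dyadic shell bound** ("we split the remaining integral into dyadic shells, estimate
`|y|^{-n-1}` on each shell, and then replace the shells with balls"):
`∫_{|y-x₀| > 2R} |v|² |y-x₀|⁻⁴ dy ≤ 8 R⁻⁴ W_R(v)` for `R > 0`.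
[cite: LeslieShvydkoy2017, §3.4, display after (3.16) (p. 11)] -/
theorem lintegral_shell_le_dyadicEnergySup (hR : 0 < R) :
    ∫⁻ y in {y | 2 * R < dist y x₀}, ‖v y‖ₑ ^ 2 / ENNReal.ofReal (dist y x₀ ^ 4) ≤
      ENNReal.ofReal (8 * (R ^ 4)⁻¹) * dyadicEnergySup v x₀ R := by
  set W := dyadicEnergySup v x₀ R with hW
  calc ∫⁻ y in {y | 2 * R < dist y x₀}, ‖v y‖ₑ ^ 2 / ENNReal.ofReal (dist y x₀ ^ 4)
      ≤ ∫⁻ y in ⋃ n : ℕ, {y | 2 ^ (n + 1) * R ≤ dist y x₀ ∧ dist y x₀ < 2 ^ (n + 2) * R},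
          ‖v y‖ₑ ^ 2 / ENNReal.ofReal (dist y x₀ ^ 4) :=
        lintegral_mono_set (shell_subset_iUnion_annuli hR)
    _ ≤ ∑' n : ℕ, ∫⁻ y in {y | 2 ^ (n + 1) * R ≤ dist y x₀ ∧ dist y x₀ < 2 ^ (n + 2) * R},
          ‖v y‖ₑ ^ 2 / ENNReal.ofReal (dist y x₀ ^ 4) := lintegral_iUnion_le _ _
    _ ≤ ∑' n : ℕ, (ENNReal.ofReal (((2 : ℝ) ^ (n + 1) * R) ^ 4))⁻¹ * (8 ^ (n + 2) * W) :=
        ENNReal.tsum_le_tsum fun n => lintegral_annulus_le hR n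
    _ = ∑' n : ℕ, (ENNReal.ofReal (4 * (R ^ 4)⁻¹) * W) * (2⁻¹ : ℝ≥0∞) ^ n := by
        refine tsum_congr fun n => ?_
        rw [← mul_assoc, annulus_const_eq hR n]
        ring
    _ = (ENNReal.ofReal (4 * (R ^ 4)⁻¹) * W) * ∑' n : ℕ, (2⁻¹ : ℝ≥0∞) ^ n := by
        rw [ENNReal.tsum_mul_left]
    _ = (ENNReal.ofReal (4 * (R ^ 4)⁻¹) * W) * 2 := by
        rw [ENNReal.tsum_geometric, ENNReal.one_sub_inv_two, inv_inv]
    _ = ENNReal.ofReal (8 * (R ^ 4)⁻¹) * W := by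
        rw [mul_assoc, mul_comm W 2, ← mul_assoc, show (2 : ℝ≥0∞) = ENNReal.ofReal 2 by norm_num,
          ← ENNReal.ofReal_mul (by positivity)]
        congr 2
        ring

end LeslieShvydkoy2018

end Literature.Analysis.FluidPDE

end
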